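import Summits.ResolutionOfSingularities.ResolutionOfSingularities.Theorems.MarkedTransferCampaignW46MohWindowSurfaceChartLine
import HarnessLib

/-!
# [OURS · L1 W4.6 rung (iii-2)] Surface Moh window — THE CHILD COUNT: over an admitted centre of the coefficient surface-window
# regime the transform has at most `2d ≤ 2(2p − 1)` singular points, EVERY `p` (cell res-hironaka, LADDER-RESOLUTION rung L, D-0089;
# seat res-L1-s46-pv-5 gen 5; host MarkedTransfer, `--supports stmt-ResolutionOfSingularities-16155 --as helper`; statement file
# `…CampaignW46MohWindowSurface.lean`)

HONEST FRAMING. Nothing here is a statement of H. Hironaka's manuscript [Hironaka2017] and nothing here asserts that any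
statement of it holds. THEOREMS about the OURS regime `CampaignW46.Regime.mohWindowSurface` (o1 §5: `E.b = p`, `Sing(E)` finite
closed, a coefficient window presentation `z^p + Σ_{k ≤ d} a_k x^{d−k} y^k`, `p < d < 2p`, at every singular point) for EVERY prime
`p`: the CHILD-COUNT lemma res-L1-type-o1 recorded as the missing input of a numeric exit bound («the multiset argument gives no
honest numeric β without a child-count lemma», `…MohWindowSurface.lean` §5 docstring of `MohWindowSurfaceTameTerminates`).
MECHANISM: a singular point `x′` of the transform over the centre `ξ` lies in the Rees chart `x` or `y` (chart `z`: unit ideal),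
on the exceptional plane, ON THE LINE `z/c_j = 0`, and the residue polynomial of that chart (`Σ ā_k X^k`, resp. `Σ ā_k X^{d−k}`)
vanishes there (`mem_line_of_singular_chart`); by `…ChartLine.lean` such primes are at most `deg ≤ d` per chart, and all points
over `ξ` sit on ONE chart family (`IsBlowup.exists_chartFamily`, res-L1-s46-pv-3). AI-written; AI review is weaker than expert
review. No `sorry`; axioms standard.

WHAT IS PROVED.
* `MohWindowSurface.mem_line_of_singular_chart` (ring level, any characteristic, `b < d < 2b`), `MohWindowSurface.not_singular_chart_two`,
  `MohWindowSurface.mem_line_of_le` (scheme level, any chart presentation).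
* `ncard_sing_inter_preimage_centre_le` — **CHILD COUNT**: for a §2.1-permissible blow-up of a state of `Regime.mohWindowSurface`
  (any `p`, any field `K` of characteristic `p`), the singular points of the transform over the centre form a finite set of
  cardinality `≤ 2 · (2p − 1)`. (Sharper: `≤ 2d`; at `p = 2` the true count is `≤ 1`, `…CentreFibre.lean`.)
[ZariskiSamuel1960] [Matsumura1987] [StacksProject] [CossartPiltant2008]
-/

noncomputable section

set_option linter.dupNamespace false -- mandated namespace of this single-conjunct summit

open CategoryTheory AlgebraicGeometry TopologicalSpace IsLocalRing

namespace Summit.ResolutionOfSingularities.ResolutionOfSingularities.Theorems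

namespace CampaignW46

open Literature.AlgebraicGeometry.Resolution
open Literature.AlgebraicGeometry.Hironaka2017.S02Preliminaries
open Literature.AlgebraicGeometry.Hironaka2017.Datum
open Literature.AlgebraicGeometry.Hironaka2017.S16Proof
open Scheme.IdealSheafData
open Polynomial

universe u

namespace MohWindowSurface

/-! ## 1. Ring level: a singular prime of the chart `i ∈ {x, y}` lies on the line `z/c_i = 0` and kills the residue polynomial -/

/-- **[OURS · L1 W4.6 rung (iii-2)] A SINGULAR POINT OF THE CHART `i ∈ {0, 1}` LIES ON THE LINE AND ON THE RESIDUE POLYNOMIAL** (ring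
level, any characteristic, `b < d < 2b`). `R` regular local of embedding dimension `3`, `c` a regular system of parameters, window
generator `g = c₂^b + Σ_{k ≤ d} a_k c_i^{d−u_k} c_{i′}^{u_k}`, `𝔴` a prime of `B_i` over `𝔪`, `L = (B_i)_𝔴`, `ψ : R → L`; if the
controlled transform `((ψ g) : (ψ c_i)^b) ⊆ 𝔪_L^b` then `c₂/c_i ∈ 𝔴` and `Σ_k a_k (c_{i′}/c_i)^{u_k} ∈ 𝔴` (`Z^b + t^{d−b} S ∈ 𝔪^b`
forces `Z ∈ 𝔪` and — since `t ∉ 𝔪²`, `d − b < b` — `S ∈ 𝔪`). NOT a statement of the manuscript. [folklore] -/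
theorem mem_line_of_singular_chart {R : Type u} [CommRing R] [IsRegularLocalRing R]
    (h3 : (maximalIdeal R).spanFinrank = 3) (c : Fin 3 → R) (hc : Ideal.span (Set.range c) = maximalIdeal R)
    {i i' : Fin 3} {b d : ℕ} (hbd : b < d) (hd2 : d < 2 * b) (a : ℕ → R) (u : ℕ → ℕ)
    (hu : ∀ k, u k ≤ d) (𝔴 : Ideal (chartRing c i)) [𝔴.IsPrime] (h𝔴 : 𝔴.comap (chartBase c i) = maximalIdeal R)
    (L : Type u) [CommRing L] [IsLocalRing L] [Algebra (chartRing c i) L] [IsLocalization.AtPrime L 𝔴]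
    (ψ : R →+* L) (hψ : ∀ r, ψ r = (algebraMap (chartRing c i) L : chartRing c i →+* L) (chartBase c i r))
    (hsing : Submodule.colon (Ideal.span {ψ (c 2 ^ b + ∑ k ∈ Finset.range (d + 1), a k * c i ^ (d - u k) * c i' ^ (u k))})
      ((Ideal.span {ψ (c i)} ^ b : Ideal L) : Set L) ≤ maximalIdeal L ^ b) :
    chartGen c i 2 ∈ 𝔴 ∧ (∑ k ∈ Finset.range (d + 1), C (a k) * X ^ (u k)).eval₂ (chartBase c i) (chartGen c i i') ∈ 𝔴 := by
  classical
  set alg : chartRing c i →+* L := (algebraMap (chartRing c i) L : chartRing c i →+* L) with halg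
  have hz0 : Ideal.span (Set.range (Fin.append c (fun k : Fin 0 => Fin.elim0 k : Fin 0 → R))) = maximalIdeal R := by
    rw [span_range_append_elim0]; exact hc
  have hd0 : (maximalIdeal R).spanFinrank = 3 + 0 := by rw [h3]
  have hrsop := isRsopPart_chartFamily_reesChart c i (fun k : Fin 0 => Fin.elim0 k) hz0 hd0 𝔴 h𝔴 L
    (a := 0) (fun k : Fin 0 => Fin.elim0 k) (Function.injective_of_subsingleton _) (fun k => Fin.elim0 k)
  haveI hLreg : IsRegularLocalRing L := hrsop.isRegularLocalRing
  haveI : IsDomain L := isDomain_of_isRegularLocalRing L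
  set t : L := ψ (c i) with htdef
  have ht : t ∈ maximalIdeal L := by
    have h0 := hrsop.mem_maximalIdeal 0
    rw [htdef, hψ]; simpa only [chartFamily, Fin.cons_zero] using h0
  have ht0 : t ≠ 0 := by
    have h0 := hrsop.ne_zero 0
    rw [htdef, hψ]; simpa only [chartFamily, Fin.cons_zero] using h0
  have ht2 : t ∉ maximalIdeal L ^ 2 := by
    have h0 := hrsop.not_mem_sq 0
    rw [htdef, hψ]; simpa only [chartFamily, Fin.cons_zero] using h0
  have hrel : ∀ l, ψ (c l) = t * alg (chartGen c i l) := fun l => by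
    rw [htdef, hψ, hψ, halg, ← map_mul, ← reesChartBase_apply_eq_mul_chartGen c i l]
  have hb0 : b ≠ 0 := by omega
  have hdb : 1 ≤ d - b := by omega
  set E : L := alg (chartGen c i i') with hE
  set Z : L := alg (chartGen c i 2) with hZ
  set S : L := ∑ k ∈ Finset.range (d + 1), ψ (a k) * E ^ (u k) with hS
  have hfac := map_window_eq_chart ψ (hrel i') (hrel 2) hbd.le a u hu
  -- the cofactor `G = Z^b + t^{d-b} S` lies in `𝔪^b`
  have hG : Z ^ b + t ^ (d - b) * S ∈ maximalIdeal L ^ b := by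
    have h1 : Submodule.colon (Ideal.span {ψ (c 2 ^ b + ∑ k ∈ Finset.range (d + 1), a k * c i ^ (d - u k) * c i' ^ (u k))})
        ((Ideal.span {ψ (c i)} ^ b : Ideal L) : Set L) = Ideal.span {Z ^ b + t ^ (d - b) * S} := by
      rw [hfac, ← htdef, colon_span_pow_mul (mem_nonZeroDivisors_of_ne_zero ht0)]
    exact hsing (h1 ▸ Ideal.mem_span_singleton_self _)
  have htS : t ^ (d - b) * S ∈ maximalIdeal L :=
    Ideal.mul_mem_right _ _ (Ideal.pow_mem_of_mem _ ht _ hdb)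
  -- `Z ∈ 𝔪`
  have hZm : Z ∈ maximalIdeal L := by
    have h1 : Z ^ b ∈ maximalIdeal L := by
      have := Ideal.sub_mem _ (Ideal.pow_le_self hb0 hG) htS
      rwa [add_sub_cancel_right] at this
    exact (maximalIdeal.isMaximal L).isPrime.mem_of_pow_mem b h1
  -- `S ∈ 𝔪`
  have hSm : S ∈ maximalIdeal L := by
    by_contra hSm
    have hSu : IsUnit S := by
      by_contra h; exact hSm ((mem_maximalIdeal _).mpr (mem_nonunits_iff.mpr h))
    have h1 : t ^ (d - b) * S ∈ maximalIdeal L ^ b := by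
      have := Ideal.sub_mem _ hG (Ideal.pow_mem_pow hZm b)
      rwa [add_sub_cancel_left] at this
    have h2 : S * t ^ (d - b) ∈ maximalIdeal L ^ (d - b + 1) := by
      rw [mul_comm]; exact Ideal.pow_le_pow_right (by omega) h1
    exact unit_mul_pow_not_mem_pow_succ ht2 hSu (d - b) h2
  -- transfer to `𝔴` (the residue polynomial element is written with `eval₂`, avoiding powers in the chart ring)
  have hSalg : alg ((∑ k ∈ Finset.range (d + 1), C (a k) * X ^ (u k)).eval₂ (chartBase c i) (chartGen c i i')) = S := by
    rw [Polynomial.hom_eval₂, Polynomial.eval₂_finsetSum, hS]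
    refine Finset.sum_congr rfl fun k _ => ?_
    rw [Polynomial.eval₂_mul, Polynomial.eval₂_C, Polynomial.eval₂_X_pow, RingHom.comp_apply, ← hψ]
  have hmem : alg ((∑ k ∈ Finset.range (d + 1), C (a k) * X ^ (u k)).eval₂ (chartBase c i) (chartGen c i i')) ∈ maximalIdeal L := by
    rw [hSalg]; exact hSm
  exact ⟨(IsLocalization.AtPrime.to_map_mem_maximal_iff L 𝔴 _).mp hZm, (IsLocalization.AtPrime.to_map_mem_maximal_iff L 𝔴 _).mp hmem⟩

/-- **The chart `z` carries no singular point** (there the transform is the unit ideal; `b < d`). [folklore] -/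
theorem not_singular_chart_two {R : Type u} [CommRing R] [IsRegularLocalRing R]
    (h3 : (maximalIdeal R).spanFinrank = 3) (c : Fin 3 → R) (hc : Ideal.span (Set.range c) = maximalIdeal R)
    {b d : ℕ} (hb0 : b ≠ 0) (hbd : b < d) (a : ℕ → R) (𝔴 : Ideal (chartRing c 2)) [𝔴.IsPrime]
    (h𝔴 : 𝔴.comap (chartBase c 2) = maximalIdeal R)
    (L : Type u) [CommRing L] [IsLocalRing L] [Algebra (chartRing c 2) L] [IsLocalization.AtPrime L 𝔴]
    (ψ : R →+* L) (hψ : ∀ r, ψ r = (algebraMap (chartRing c 2) L : chartRing c 2 →+* L) (chartBase c 2 r))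
    (hsing : Submodule.colon (Ideal.span {ψ (c 2 ^ b + ∑ k ∈ Finset.range (d + 1), a k * c 0 ^ (d - k) * c 1 ^ k)})
      ((Ideal.span {ψ (c 2)} ^ b : Ideal L) : Set L) ≤ maximalIdeal L ^ b) : False := by
  classical
  set alg : chartRing c 2 →+* L := (algebraMap (chartRing c 2) L : chartRing c 2 →+* L) with halg
  have hz0 : Ideal.span (Set.range (Fin.append c (fun k : Fin 0 => Fin.elim0 k : Fin 0 → R))) = maximalIdeal R := by
    rw [span_range_append_elim0]; exact hc
  have hd0 : (maximalIdeal R).spanFinrank = 3 + 0 := by rw [h3]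
  have hrsop := isRsopPart_chartFamily_reesChart c 2 (fun k : Fin 0 => Fin.elim0 k) hz0 hd0 𝔴 h𝔴 L
    (a := 0) (fun k : Fin 0 => Fin.elim0 k) (Function.injective_of_subsingleton _) (fun k => Fin.elim0 k)
  haveI hLreg : IsRegularLocalRing L := hrsop.isRegularLocalRing
  haveI : IsDomain L := isDomain_of_isRegularLocalRing L
  set t : L := ψ (c 2) with htdef
  have ht : t ∈ maximalIdeal L := by
    have h0 := hrsop.mem_maximalIdeal 0
    rw [htdef, hψ]; simpa only [chartFamily, Fin.cons_zero] using h0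
  have ht0 : t ≠ 0 := by
    have h0 := hrsop.ne_zero 0
    rw [htdef, hψ]; simpa only [chartFamily, Fin.cons_zero] using h0
  have hrel : ∀ l, ψ (c l) = t * alg (chartGen c 2 l) := fun l => by
    rw [htdef, hψ, hψ, halg, ← map_mul, ← reesChartBase_apply_eq_mul_chartGen c 2 l]
  have hfac := map_window_eq_chart_two ψ (hrel 0) (hrel 1) hbd.le a (d := d)
  have hG : 1 + t ^ (d - b) * ∑ k ∈ Finset.range (d + 1), ψ (a k) * alg (chartGen c 2 0) ^ (d - k) * alg (chartGen c 2 1) ^ k ∈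
      maximalIdeal L ^ b := by
    have h1 : Submodule.colon (Ideal.span {ψ (c 2 ^ b + ∑ k ∈ Finset.range (d + 1), a k * c 0 ^ (d - k) * c 1 ^ k)})
        ((Ideal.span {ψ (c 2)} ^ b : Ideal L) : Set L) =
        Ideal.span {1 + t ^ (d - b) * ∑ k ∈ Finset.range (d + 1), ψ (a k) * alg (chartGen c 2 0) ^ (d - k) * alg (chartGen c 2 1) ^ k} := by
      rw [hfac, ← htdef, colon_span_pow_mul (mem_nonZeroDivisors_of_ne_zero ht0)]
    exact hsing (h1 ▸ Ideal.mem_span_singleton_self _)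
  have hu := isUnit_chart_two_cofactor ht hbd
    (S := ∑ k ∈ Finset.range (d + 1), ψ (a k) * alg (chartGen c 2 0) ^ (d - k) * alg (chartGen c 2 1) ^ k)
  exact (maximalIdeal.isMaximal L).ne_top (Ideal.eq_top_of_isUnit_mem _ (Ideal.pow_le_self hb0 hG) hu)

/-! ## 2. Scheme level: any chart presentation of a singular point over the centre -/

section Local

variable {X X' : Scheme.{u}} {π : X' ⟶ X}

set_option maxHeartbeats 800000 in
-- the chart rings over `CommRingCat.of` stalks elaborate large terms (as in the tree's `IsBlowup.exists_chart_morphism`)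
/-- **For ANY chart presentation `q : Spec B_j → X′` through a point `x′` over a centre point `s`** with window presentation
`J_s = (c₂^b + Σ_{k ≤ d} a_k c₀^{d−k} c₁^k)`, `b < d < 2b`, `𝓘_{Y,s} = 𝔪_s = (c₀, c₁, c₂)`: if the controlled transform has order
`≥ b` at `x′`, then `j ≠ 2`, the prime of `x′` lies over `𝔪_s`, contains `c_j` and `c₂/c_j`, and contains the chart's residue
polynomial element `Σ a_k (c_{j′}/c_j)^{u_k}` (`j′ = 1, u_k = min k d` for `j = 0`; `j′ = 0, u_k = d − k` for `j = 1`). NOT a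
statement of the manuscript. [cite: StacksProject, Tag 0804] -/
theorem mem_line_of_le [IsLocallyNoetherian X'] {Y : Closeds X} {J : X.IdealSheafData} {s : X} {x' : X'}
    (hx : π x' = s) [IsRegularLocalRing (X.presheaf.stalk s)] (hdim : (maximalIdeal (X.presheaf.stalk s)).spanFinrank = 3)
    (c : Fin 3 → X.presheaf.stalk s) (hc : Ideal.span (Set.range c) = maximalIdeal _)
    (hY : stalkIdeal (vanishingIdeal Y) s = maximalIdeal _) {b d : ℕ} (hbd : b < d) (hd2 : d < 2 * b)
    (a : ℕ → X.presheaf.stalk s)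
    (hJ : stalkIdeal J s = Ideal.span {c 2 ^ b + ∑ k ∈ Finset.range (d + 1), a k * c 0 ^ (d - k) * c 1 ^ k})
    (j : Fin 3) (q : Spec (.of (chartRing c j)) ⟶ X') (w : Spec (.of (chartRing c j))) (hq : q w = x')
    [IsIso (q.stalkMap w)]
    (hsq : q ≫ π = Spec.map (CommRingCat.ofHom (chartBase c j)) ≫ X.fromSpecStalk s)
    (hle : (b : ℕ∞) ≤ idealOrder (controlledTransform π (vanishingIdeal Y) J b) x') :
    j ≠ 2 ∧ chartBase c j (c j) ∈ w.asIdeal ∧ chartGen c j 2 ∈ w.asIdeal ∧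
      (∑ k ∈ Finset.range (d + 1), Polynomial.C (a k) *
          Polynomial.X ^ ((![fun k => min k d, fun k => d - k, fun _ => 0] : Fin 3 → ℕ → ℕ) j k)).eval₂
        (chartBase c j) (chartGen c j ((![1, 0, 0] : Fin 3 → Fin 3) j)) ∈ w.asIdeal := by
  classical
  subst hx
  obtain ⟨χ, hχ₀, hloc, h𝔴⟩ :=
    exists_stalk_ringHom_of_chart π x' (CommRingCat.ofHom (chartBase c j)) q w hq hsq
  have hχ : ∀ r, χ (chartBase c j r) = (π.stalkMap x').hom r := fun r => hχ₀ r
  have h𝔴' : w.asIdeal.comap (chartBase c j) = maximalIdeal (X.presheaf.stalk (π x')) := h𝔴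
  clear hχ₀ h𝔴
  letI := χ.toAlgebra
  haveI : IsLocalization.AtPrime (X'.presheaf.stalk x') w.asIdeal := hloc
  obtain ⟨ψ, hψ⟩ : ∃ ψ : X.presheaf.stalk (π x') →+* X'.presheaf.stalk x', ψ = (π.stalkMap x').hom := ⟨_, rfl⟩
  have hψa : ∀ r, ψ r = (algebraMap (chartRing c j) (X'.presheaf.stalk x') :
      chartRing c j →+* X'.presheaf.stalk x') (chartBase c j r) := fun r => by rw [hψ]; exact (hχ r).symm
  have hrel : ∀ l, ψ (c l) = ψ (c j) * χ (chartGen c j l) := by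
    rw [hψ]; exact stalkMap_apply_eq_mul_chartGen j χ hχ
  have hcY : Ideal.span (Set.range c) = stalkIdeal (vanishingIdeal Y) (π x') := hc.trans hY.symm
  have hCmap : (stalkIdeal (vanishingIdeal Y) (π x')).map ψ = Ideal.span {ψ (c j)} := by
    rw [← hcY, Ideal.map_span_range_eq_span_singleton _ c j _ hrel]
  have hstalk : stalkIdeal (controlledTransform π (vanishingIdeal Y) J b) x' =
      Submodule.colon (Ideal.span {ψ (c 2 ^ b + ∑ k ∈ Finset.range (d + 1), a k * c 0 ^ (d - k) * c 1 ^ k)})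
        ((Ideal.span {ψ (c j)} ^ b : Ideal _) : Set _) := by
    rw [controlledTransform, stalkIdeal_colon, stalkIdeal_pow, stalkIdeal_comap_eq_map_stalkMap,
      stalkIdeal_comap_eq_map_stalkMap, ← hψ, hCmap, hJ, Ideal.map_span, Set.image_singleton]
  have hsing : Submodule.colon (Ideal.span {ψ (c 2 ^ b + ∑ k ∈ Finset.range (d + 1), a k * c 0 ^ (d - k) * c 1 ^ k)})
      ((Ideal.span {ψ (c j)} ^ b : Ideal _) : Set _) ≤ maximalIdeal (X'.presheaf.stalk x') ^ b := by
    rw [← hstalk]; exact (le_idealOrder_iff _ x' b).mp hle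
  have hcj : chartBase c j (c j) ∈ w.asIdeal := by
    rw [← Ideal.mem_comap, h𝔴', ← hc]; exact Ideal.subset_span ⟨j, rfl⟩
  -- which chart?
  obtain rfl | rfl | rfl : j = 0 ∨ j = 1 ∨ j = 2 := by
    rcases j with ⟨j, hj⟩
    have : j = 0 ∨ j = 1 ∨ j = 2 := by omega
    rcases this with rfl | rfl | rfl
    · exact Or.inl rfl
    · exact Or.inr (Or.inl rfl)
    · exact Or.inr (Or.inr rfl)
  · rw [window_sum_chart_zero] at hsing
    obtain ⟨h2, hS⟩ := mem_line_of_singular_chart hdim c hc (i := 0) (i' := 1) hbd hd2 a (fun k => min k d)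
      (fun k => min_le_right k d) w.asIdeal h𝔴' (X'.presheaf.stalk x') ψ hψa hsing
    refine ⟨by decide, hcj, h2, ?_⟩
    simpa only [Matrix.cons_val_zero] using hS
  · rw [window_sum_chart_one] at hsing
    obtain ⟨h2, hS⟩ := mem_line_of_singular_chart hdim c hc (i := 1) (i' := 0) hbd hd2 a (fun k => d - k)
      (fun k => Nat.sub_le d k) w.asIdeal h𝔴' (X'.presheaf.stalk x') ψ hψa hsing
    refine ⟨by decide, hcj, h2, ?_⟩
    simpa only [Matrix.cons_val_one, Matrix.cons_val_zero] using hS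
  · exact (not_singular_chart_two hdim c hc (by omega) hbd a w.asIdeal h𝔴' (X'.presheaf.stalk x') ψ hψa hsing).elim

end Local

/-! ## 3. The residue polynomials of the two charts: nonzero of degree `≤ d` -/

section ResiduePoly

variable {κ : Type*} [CommRing κ]

/-- The chart residue polynomial `Σ_{k ≤ d} C(b k) X^{e k}` has degree `≤ d` when `e k ≤ d`. [folklore] -/
theorem natDegree_residuePoly_le (d : ℕ) (b : ℕ → κ) (e : ℕ → ℕ) (he : ∀ k, e k ≤ d) :
    (∑ k ∈ Finset.range (d + 1), C (b k) * X ^ (e k)).natDegree ≤ d :=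
  natDegree_sum_le_of_forall_le _ _ fun k _ => (natDegree_C_mul_X_pow_le (b k) (e k)).trans (he k)

/-- The coefficient of `X^{e k₀}` in `Σ_{k ≤ d} C(b k) X^{e k}` is `b k₀` when `e` is injective on `{0, …, d}` and `k₀ ≤ d`.
[folklore] -/
theorem coeff_residuePoly (d : ℕ) (b : ℕ → κ) (e : ℕ → ℕ) (he : ∀ k ≤ d, ∀ k' ≤ d, e k = e k' → k = k') {k₀ : ℕ}
    (hk₀ : k₀ ≤ d) : (∑ k ∈ Finset.range (d + 1), C (b k) * X ^ (e k)).coeff (e k₀) = b k₀ := by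
  rw [finsetSum_coeff]
  simp only [coeff_C_mul_X_pow]
  rw [Finset.sum_eq_single k₀]
  · rw [if_pos rfl]
  · intro k hk hkk₀
    rw [if_neg]
    intro h
    exact hkk₀ (he k (Nat.lt_succ_iff.mp (Finset.mem_range.mp hk)) k₀ hk₀ h.symm)
  · intro h; exact absurd (Finset.mem_range.mpr (Nat.lt_succ_of_le hk₀)) h

end ResiduePoly

end MohWindowSurface

/-! ## 4. The campaign regime: the child count over an admitted centre, every `p` -/

section Campaign

variable {p : ℕ} [Fact p.Prime] {K : Type u} [Field K] [CharP K p]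
variable {A A' : AmbientDatum p K} {E : IdealExponent A.Z}

set_option maxHeartbeats 800000 in
-- several chart-ring computations over `CommRingCat.of` stalks in one proof
/-- **[OURS · L1 W4.6 rung (iii-2)] THE CHILD COUNT, EVERY `p`.** Let `π : Z′ → Z` be a §2.1-permissible blow-up of a state `(A, E)`
of `Regime.mohWindowSurface` (o1 §5; any prime `p`, any field `K` of characteristic `p`). Then the set of singular points of the
transform `E′` lying over the centre is FINITE, of cardinality at most `2 · (2p − 1)`: they lie on one chart family over the centre
point `ξ` (`IsBlowup.exists_chartFamily`), in the charts `x`, `y` only, on the exceptional line `z/c_j = 0` and on the residue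
polynomial of the chart (`MohWindowSurface.mem_line_of_le`), and each chart contributes at most `deg ≤ d ≤ 2p − 1` such primes
(`MohWindowSurface.ncard_linePrimes_le`). No hypothesis on the transform. NOT a statement of the manuscript. [folklore] -/
theorem ncard_sing_inter_preimage_centre_le {D : Closeds A.Z} (π : A'.Z ⟶ A.Z) (hπ : IsBlowup π (vanishingIdeal D))
    (hD : E.IsPermissibleCentre A.hom D) (hRg : Regime.mohWindowSurface A E) :
    ((E.transform π D).sing ∩ π.base ⁻¹' (D : Set A.Z)).Finite ∧
      ((E.transform π D).sing ∩ π.base ⁻¹' (D : Set A.Z)).ncard ≤ 2 * (2 * p - 1) := by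
  classical
  obtain ⟨ξ, hξS, hξcl, hDξ⟩ := IsPermissibleCentre.exists_eq_singleton_of_isolatedSing hD ⟨hRg.2.1, hRg.2.2.1⟩
  obtain ⟨hb, -, -, hwin⟩ := hRg
  haveI : IsLocallyNoetherian A'.Z := by
    haveI := A'.smooth
    exact LocallyOfFiniteType.isLocallyNoetherian A'.hom
  obtain ⟨hRreg, h3, x, y, z, hxyz, d, a, hbd, hd2, hunit, hJ⟩ := hwin ξ hξS
  rw [hb] at hbd hd2 hJ
  haveI := hRreg
  -- one chart family for all points over `ξ`
  set c : Fin 3 → A.Z.presheaf.stalk ξ := ![x, y, z] with hc_def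
  have hc : Ideal.span (Set.range c) = maximalIdeal _ := by rw [hc_def, MohWindowSurface.range_vec3]; exact hxyz
  have hY : stalkIdeal (vanishingIdeal D) ξ = maximalIdeal (A.Z.presheaf.stalk ξ) := by
    apply stalkIdeal_vanishingIdeal_eq_maximalIdeal_of_closure_eq
    rw [hDξ, hξcl.closure_eq]
  have hcY : Ideal.span (Set.range c) = stalkIdeal (vanishingIdeal D) ξ := hc.trans hY.symm
  obtain ⟨q, hq, hpts⟩ := hπ.exists_chartFamily ξ c hcY
  have hJc : stalkIdeal E.J ξ = Ideal.span {c 2 ^ p + ∑ k ∈ Finset.range (d + 1), a k * c 0 ^ (d - k) * c 1 ^ k} := by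
    rw [hJ, hc_def]; rfl
  haveI hImax : (Ideal.span (Set.range c)).IsMaximal := by rw [hc]; exact maximalIdeal.isMaximal _
  -- the line sets of the two charts
  set V0 : Set (Spec (.of (chartRing c 0))) := {w | chartBase c 0 (c 0) ∈ w.asIdeal ∧ chartGen c 0 2 ∈ w.asIdeal ∧
      (∑ k ∈ Finset.range (d + 1), C (a k) * X ^ (min k d)).eval₂ (chartBase c 0) (chartGen c 0 1) ∈ w.asIdeal} with hV0def
  set V1 : Set (Spec (.of (chartRing c 1))) := {w | chartBase c 1 (c 1) ∈ w.asIdeal ∧ chartGen c 1 2 ∈ w.asIdeal ∧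
      (∑ k ∈ Finset.range (d + 1), C (a k) * X ^ (d - k)).eval₂ (chartBase c 1) (chartGen c 1 0) ∈ w.asIdeal} with hV1def
  -- every singular point over the centre is on one of the two lines
  have hsub : (E.transform π D).sing ∩ π.base ⁻¹' (D : Set A.Z) ⊆ (q 0).base '' V0 ∪ (q 1).base '' V1 := by
    rintro x' ⟨hx', hover⟩
    have hπx : π.base x' = ξ := by simpa [hDξ] using hover
    obtain ⟨j, w, hqw, hiso⟩ := hpts x' hπx
    have hle : (p : ℕ∞) ≤ idealOrder (controlledTransform π (vanishingIdeal D) E.J p) x' := by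
      have := hx'
      simp only [IdealExponent.sing, IdealExponent.transform, Set.mem_setOf_eq, hb] at this
      exact_mod_cast this
    haveI := hiso
    obtain ⟨hj2, hcj, h2, hS⟩ := MohWindowSurface.mem_line_of_le (π := π) hπx h3 c hc hY hbd hd2 a hJc j (q j) w hqw (hq j) hle
    obtain rfl | rfl : j = 0 ∨ j = 1 := by
      rcases j with ⟨j, hj⟩
      have : j = 0 ∨ j = 1 ∨ j = 2 := by omega
      rcases this with rfl | rfl | rfl
      · exact Or.inl rfl
      · exact Or.inr rfl
      · exact absurd rfl hj2
    · simp only [Matrix.cons_val_zero] at hS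
      exact Or.inl ⟨w, ⟨hcj, h2, hS⟩, hqw⟩
    · simp only [Matrix.cons_val_one, Matrix.cons_val_zero] at hS
      exact Or.inr ⟨w, ⟨hcj, h2, hS⟩, hqw⟩
  -- the count per chart
  have hd : d ≤ 2 * p - 1 := by omega
  obtain ⟨k₀, hk₀, hk₀u⟩ := hunit
  have hmk : ∀ r, IsUnit r → Ideal.Quotient.mk (Ideal.span (Set.range c)) r ≠ 0 := fun r hr h =>
    hImax.ne_top (Ideal.eq_top_of_isUnit_mem _ (Ideal.Quotient.eq_zero_iff_mem.mp h) hr)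
  -- compatibility of the two readings of the residue polynomial (chart ring modulo `c_j` vs `κ[T]`)
  have hcompat : ∀ (j a' : Fin 3) (hja : a' ≠ j) (P : (A.Z.presheaf.stalk ξ)[X]),
      Ideal.Quotient.mk (Ideal.span {chartBase c j (c j)}) (P.eval₂ (chartBase c j) (chartGen c j a')) =
        chartQuotMap c j ((P.map (Ideal.Quotient.mk (Ideal.span (Set.range c)))).eval₂
          (MvPolynomial.C : _ →+* MvPolynomial {l : Fin 3 // l ≠ j} _) (MvPolynomial.X ⟨a', hja⟩)) := by
    intro j a' hja P
    have hfg : ((chartQuotMap c j).comp (MvPolynomial.C : _ →+* MvPolynomial {l : Fin 3 // l ≠ j} _)).comp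
        (Ideal.Quotient.mk (Ideal.span (Set.range c))) =
        (Ideal.Quotient.mk (Ideal.span {chartBase c j (c j)})).comp (chartBase c j) :=
      RingHom.ext fun r => by simp only [RingHom.comp_apply, chartQuotMap_C]
    rw [Polynomial.hom_eval₂, Polynomial.hom_eval₂, Polynomial.eval₂_map, chartQuotMap_X, hfg]
  have hP0 : ∀ (e : ℕ → ℕ), (∀ k ≤ d, ∀ k' ≤ d, e k = e k' → k = k') →
      (∑ k ∈ Finset.range (d + 1), C (a k) * X ^ (e k)).map (Ideal.Quotient.mk (Ideal.span (Set.range c))) ≠ 0 := by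
    intro e he h
    have h1 := MohWindowSurface.coeff_residuePoly d a e he hk₀
    have h2 : ((∑ k ∈ Finset.range (d + 1), C (a k) * X ^ (e k)).map (Ideal.Quotient.mk (Ideal.span (Set.range c)))).coeff (e k₀) =
        Ideal.Quotient.mk (Ideal.span (Set.range c)) (a k₀) := by rw [Polynomial.coeff_map, h1]
    rw [h, coeff_zero] at h2
    exact hmk _ hk₀u h2.symm
  have hV0 : V0.Finite ∧ V0.ncard ≤ d := by
    obtain ⟨hfin, hcard⟩ := MohWindowSurface.ncard_linePrimes_le h3 c hc 0 (a := 1) (by decide) (by decide) (by decide)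
      ((∑ k ∈ Finset.range (d + 1), C (a k) * X ^ (min k d)).eval₂ (chartBase c 0) (chartGen c 0 1)) _
      (hP0 (fun k => min k d) (fun k hk k' hk' hkk' => by rwa [min_eq_left hk, min_eq_left hk'] at hkk'))
      (hcompat 0 1 (by decide) _)
    exact ⟨hfin, hcard.trans (Polynomial.natDegree_map_le.trans
      (MohWindowSurface.natDegree_residuePoly_le d a _ fun k => min_le_right k d))⟩
  have hV1 : V1.Finite ∧ V1.ncard ≤ d := by
    obtain ⟨hfin, hcard⟩ := MohWindowSurface.ncard_linePrimes_le h3 c hc 1 (a := 0) (by decide) (by decide) (by decide)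
      ((∑ k ∈ Finset.range (d + 1), C (a k) * X ^ (d - k)).eval₂ (chartBase c 1) (chartGen c 1 0)) _
      (hP0 (fun k => d - k) (fun k hk k' hk' hkk' => by omega))
      (hcompat 1 0 (by decide) _)
    exact ⟨hfin, hcard.trans (Polynomial.natDegree_map_le.trans
      (MohWindowSurface.natDegree_residuePoly_le d a _ fun k => Nat.sub_le d k))⟩
  have hfinU : ((q 0).base '' V0 ∪ (q 1).base '' V1).Finite := (hV0.1.image _).union (hV1.1.image _)
  refine ⟨hfinU.subset hsub, ?_⟩
  calc ((E.transform π D).sing ∩ π.base ⁻¹' (D : Set A.Z)).ncard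
      ≤ ((q 0).base '' V0 ∪ (q 1).base '' V1).ncard := Set.ncard_le_ncard hsub hfinU
    _ ≤ ((q 0).base '' V0).ncard + ((q 1).base '' V1).ncard := Set.ncard_union_le _ _
    _ ≤ V0.ncard + V1.ncard := Nat.add_le_add (Set.ncard_image_le hV0.1) (Set.ncard_image_le hV1.1)
    _ ≤ d + d := Nat.add_le_add hV0.2 hV1.2
    _ ≤ 2 * (2 * p - 1) := by omega

end Campaign

end CampaignW46

end Summit.ResolutionOfSingularities.ResolutionOfSingularities.Theorems

end
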